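import Summits.QuantumFields.BalabanUV.Beta.CompositeCorrectorKernelSpr
import Summits.QuantumFields.BalabanUV.Beta.CompositeCorrectorCovarianceGeneric
import Summits.QuantumFields.BalabanUV.Beta.CompositeCorrectorLinearGeneric
import Summits.QuantumFields.BalabanUV.Beta.CompositeCorrectorLocalityGeneric
import Summits.QuantumFields.BalabanUV.Beta.BorderedHessianSymmetry

/-!
# `BalabanUV.Beta.CompositeCorrectorKernelSym` — binder row D1 ∕ (C1), K-U3d-sym leaf L2: **THE (0.4)-COMPOSITE CORRECTOR PAIR AS PACKED-FIBRE KERNELS** —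
# `psiKSym r L m := kerOf (corrPsiSym r L m)`, `phiKSym r L m := kerOf (corrPhiSym r L m)` (PART 126's (0.4)-composite corrector forms kernelised exactly as K-U3d L2
# `CompositeCorrectorKernel.psiK ∕ phiK` kernelise the rooted ones) with their ENTRIES, BLOCK COVARIANCE, finite RANGE `0` in block units, DECAY at every rate
# (`Spr`), the six APPLY BRIDGES and `sgnK`-invariance — every displayed corrector letter of the all-(0.4) presentation (`hΨ`, `hΦ`, `hΨt`, `hΨσ`; road XREAD-L∕ES∕HB∕HJ,
# row REFEREE-TABLE-92 §C) as a THEOREM.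

HONEST FRAMING (cell charter, verbatim): «discharging BetaPertH makes Balaban's UV stability UNCONDITIONAL — a real
constructive-QFT result; it is NOT the continuum limit and NOT the Clay problem.»
HONEST DEPENDENCY: continuum YM on T⁴ ⇐ BetaPertH ∧ nine spine estimates (0/9 proved); BetaPertH ⇐ (D1) ∧ (D4) ∧ CAP+tail;
G-an2-4 gates asym, D1 and NE2/3/4.
ABSOLUTE RULE (cell, verbatim): «No internally-minted statement may enter as a cited fact. Every hypothesis is either kernel-proved in this
package or a verbatim quotation of a PUBLISHED theorem with page reference. The manuscript(s) under audit are NOT citable for their own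
disputed steps — they are the thing under adjudication; programme-internal (2001/route/tribunal) claims are never citable.»
NOTHING below is cited: no `[cite: …]`, no `def … : Prop`, 0 sorry.  Two [our object — bookkeeping] definitions (the kernelisations of two existing linear maps,
asserting nothing) + [folklore] instantiations of K-U3d L2's GENERIC kernel calculus (t4-ne9-formalise-leaf-06 g32 `CompositeCorrectorKernel`: `kerOf`, `kerOf_shift`,
`apply_indR_eq_zero_of_not_mem`, `comp_kerOf_inl ∕ _inr`, `comp_trK_kerOf_inl ∕ _inr`; leaf-09 `CompositeCorrectorKernelSpr`: `decays_of_blockShift_of_range`) fed PART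
127–129's landed (0.4)-composite form-level facts (`CompositeAveragingCoarseExactGeneric.corrPsiSym_shift ∕ corrPhiSym_shift`, `depOn_corrPsiSym ∕ depOn_corrPhiSym`,
`corrPsiSym_zero ∕ corrPhiSym_zero`, `corrPsiSym_sum_smul ∕ corrPhiSym_sum_smul`) — each proof is its rooted twin's VERBATIM up to those names.

WHY (row D1 OWNER an2 gen 91∕92: XREAD-SC v1.1 8f0cd0b0, XREAD-RS v1.1 5c8b0600 — unfiled xreads, chair leaf-03 XCHK-SC∕XCHK-RS 48∕48 HOLD 0; REFEREE-TABLE-92 §C; road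
FP `D1-END-DECISION-BRIEF-g70.md` option (b)∕(c)).  The all-(0.4) presentation of row D1's END (road XREAD-L v1.4: the sym composite chart `ANs R Ψs j := Ψs (j+1) ∘
coDressKBmAt … KInv ∘ (Ψs (j+1))ᵀ`) displays its corrector family `Ψs` with letters; at `Ψs := psiKSym R.rc Lc` every one of them is a theorem of this file.  By value the
all-(0.4) tower telescopes at (2,3) (Engine C SYM2 (ii), `SPAN-SYM2.addendum4.md` 56c550e9, RULING SYM2-10 — ONE lattice, informational, zero weight on any binder).
WHAT THIS IS NOT: not the inverse pair ∕ slice rules (K-U3d-sym L3, `CompositeCorrectorRulesSym`), not the `RelInv` END, not `ANs`, not a claim about any other lattice;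
nothing of Bałaban's asserted, valued or discharged; 0 estimates; 0∕4 row-D1 binders (hW ∕ hR ∕ D1Tel ∕ D1Rep); the literal of record, ROOT M‴ ∕ P5c ∕ D6, v10 + END v3 + W
untouched; NOT (C1), NOT (T-ID), NOT D1, NEVER «G-an2-4 closed», NOT BetaPertH, NOT continuum, NOT Clay.

WHAT (`d+1` the lattice dimension; `L` the block side, `m` levels; roots `r k ∈ box (d+1) L`; all [folklore] unless marked):
§1 [our object] `psiKSym`, `phiKSym` + the eight entries (`rfl`).  §2 `psiKSym_shift`∕`phiKSym_shift`, `shiftK_(neg_)psiKSym`∕`shiftK_(neg_)phiKSym` (PART 129);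
`psiKSym_inl_inl_eq_zero`∕`phiKSym_…` (PART 127), `psiKSym_eq_idK_of_blk_ne`∕`phiKSym_…`, `decays_psiKSym`∕`decays_phiKSym`, **`spr_psiKSym`∕`spr_phiKSym`**.
§3 `comp_psiKSym_inl∕_inr`, `comp_phiKSym_inl∕_inr`, `comp_trK_psiKSym_inl∕_inr`, `comp_trK_phiKSym_inl∕_inr`.  §4 `sgnK_kerOf` (generic), `sgnK_psiKSym`, `sgnK_phiKSym`.
Provenance: β sub-cell, unit beta-an2 gen 92 (prover-b2b-balaban-beta-an2-g92-0), 2026-08-31.  No existing file touched.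
-/

namespace Summit.QuantumFields.BalabanUV.Beta.CompositeCorrectorKernelSym

open Finset
open scoped BigOperators
open Literature.MathematicalPhysics.QuantumFieldTheory
open Literature.MathematicalPhysics.QuantumFieldTheory.Balaban1983to89
open Literature.MathematicalPhysics.QuantumFieldTheory.Balaban1983to89.Beta
open ExpKernelCalculus (MKer Decays shiftK comp)
open HessKerSchurResolvent (idK idK_apply)
open OneStepResolventKernel (Fib)
open AffineAveraging (Site Form1 box toSite unitVec dz curv)
open AveragingContours (blk shift)
open Summit.QuantumFields.BalabanUV.Beta.TameKernelCalculus (Spr trK)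
open Summit.QuantumFields.BalabanUV.Beta.BorderedHessian (sgnF sgnK sgnK_apply sgnF_inl sgnF_inr)
open Summit.QuantumFields.BalabanUV.Beta.CompositeCorrectorKernel (kerOf kerOf_inl_inl kerOf_inl_inr kerOf_inr_inl kerOf_inr_inr indR indR_apply
  apply_indR_eq_zero_of_not_mem kerOf_shift kerBound decays_of_blockShift_of_range
  comp_kerOf_inl comp_kerOf_inr comp_trK_kerOf_inl comp_trK_kerOf_inr exists_finset_corrReads)
open Summit.QuantumFields.BalabanUV.Beta.CompositeCorrectorLocality (CorrReads)
open Summit.QuantumFields.BalabanUV.Beta.CompositeAveragingCoarseExactGeneric (corrPsiSym corrPhiSym corrPsiSym_shift corrPhiSym_shift corrPsiSym_zero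
  corrPhiSym_zero depOn_corrPsiSym depOn_corrPhiSym corrPsiSym_sum_smul corrPhiSym_sum_smul)

noncomputable section

variable {d : ℕ}

/-! ## §1 The kernelised (0.4)-composite correctors and their entries -/

/-- [our object — bookkeeping] **`Ψ̂ˢ_m := kerOf Ψˢ_m`** — K-U3d's `psiK := kerOf (corrPsi r L m)` with `corrPsi ↦ corrPsiSym` (PART 126). -/
def psiKSym (r : ℕ → (Fin (d + 1) → ℕ)) (L m : ℕ) : MKer (d + 1) (Fib d) := kerOf (corrPsiSym r L m)

/-- [our object — bookkeeping] **`Φ̂ˢ_m := kerOf Φˢ_m`** — the inverse corrector, kernelised. -/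
def phiKSym (r : ℕ → (Fin (d + 1) → ℕ)) (L m : ℕ) : MKer (d + 1) (Fib d) := kerOf (corrPhiSym r L m)

section Entries

variable (r : ℕ → (Fin (d + 1) → ℕ)) (L m : ℕ) (x y : Site (d + 1))

/-- [folklore] `Ψ̂ˢ` field–field entry. -/
theorem psiKSym_inl_inl (α β : Fin (d + 1)) : psiKSym r L m x y (Sum.inl α) (Sum.inl β) = corrPsiSym r L m (indR β y) α x := rfl
/-- [folklore] `Ψ̂ˢ` field–multiplier entry vanishes. -/
theorem psiKSym_inl_inr (α μ : Fin (d + 1)) : psiKSym r L m x y (Sum.inl α) (Sum.inr μ) = 0 := rfl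
/-- [folklore] `Ψ̂ˢ` multiplier–field entry vanishes. -/
theorem psiKSym_inr_inl (μ α : Fin (d + 1)) : psiKSym r L m x y (Sum.inr μ) (Sum.inl α) = 0 := rfl
/-- [folklore] `Ψ̂ˢ` multiplier–multiplier entry is the identity. -/
theorem psiKSym_inr_inr (μ μ' : Fin (d + 1)) : psiKSym r L m x y (Sum.inr μ) (Sum.inr μ') = if x = y ∧ μ = μ' then 1 else 0 := rfl
/-- [folklore] `Φ̂ˢ` field–field entry. -/
theorem phiKSym_inl_inl (α β : Fin (d + 1)) : phiKSym r L m x y (Sum.inl α) (Sum.inl β) = corrPhiSym r L m (indR β y) α x := rfl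
/-- [folklore] `Φ̂ˢ` field–multiplier entry vanishes. -/
theorem phiKSym_inl_inr (α μ : Fin (d + 1)) : phiKSym r L m x y (Sum.inl α) (Sum.inr μ) = 0 := rfl
/-- [folklore] `Φ̂ˢ` multiplier–field entry vanishes. -/
theorem phiKSym_inr_inl (μ α : Fin (d + 1)) : phiKSym r L m x y (Sum.inr μ) (Sum.inl α) = 0 := rfl
/-- [folklore] `Φ̂ˢ` multiplier–multiplier entry is the identity. -/
theorem phiKSym_inr_inr (μ μ' : Fin (d + 1)) : phiKSym r L m x y (Sum.inr μ) (Sum.inr μ') = if x = y ∧ μ = μ' then 1 else 0 := rfl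

end Entries

/-! ## §2 Block covariance and spread of both correctors (K-U3d L2's generic §2 at the (0.4) forms) -/

section Shift

/-- [folklore] **BLOCK-TRANSLATION COVARIANCE OF `Ψ̂ˢ`** (`kerOf_shift` + PART 129 `corrPsiSym_shift`). -/
theorem psiKSym_shift {L : ℕ} (hL : 1 ≤ L) (r : ℕ → (Fin (d + 1) → ℕ)) (m : ℕ) (x y v : Site (d + 1)) (a b : Fib d) :
    psiKSym r L m (x + (((L ^ m : ℕ) : ℤ)) • v) (y + (((L ^ m : ℕ) : ℤ)) • v) a b = psiKSym r L m x y a b :=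
  kerOf_shift (fun A => corrPsiSym_shift (r := r) hL m A v) x y a b

/-- [folklore] **BLOCK-TRANSLATION COVARIANCE OF `Φ̂ˢ`** (`kerOf_shift` + PART 129 `corrPhiSym_shift`). -/
theorem phiKSym_shift {L : ℕ} (hL : 1 ≤ L) (r : ℕ → (Fin (d + 1) → ℕ)) (m : ℕ) (x y v : Site (d + 1)) (a b : Fib d) :
    phiKSym r L m (x + (((L ^ m : ℕ) : ℤ)) • v) (y + (((L ^ m : ℕ) : ℤ)) • v) a b = phiKSym r L m x y a b :=
  kerOf_shift (fun A => corrPhiSym_shift (r := r) hL m A v) x y a b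

/-- [folklore] `shiftK (n • v) Ψ̂ˢ = Ψ̂ˢ`, `n = L^m`. -/
theorem shiftK_psiKSym {L : ℕ} (hL : 1 ≤ L) (r : ℕ → (Fin (d + 1) → ℕ)) (m : ℕ) (v : Site (d + 1)) :
    shiftK ((((L ^ m : ℕ) : ℤ)) • v) (psiKSym r L m) = psiKSym r L m := by
  funext x y a b
  exact psiKSym_shift hL r m x y v a b

/-- [folklore] `shiftK (−(n • t)) Ψ̂ˢ = Ψ̂ˢ` (the sign convention of `AxialDressingRootedBmKernel.shiftK_coDressKBmAt`, as the rooted `shiftK_neg_psiK`). -/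
theorem shiftK_neg_psiKSym {L : ℕ} (hL : 1 ≤ L) (r : ℕ → (Fin (d + 1) → ℕ)) (m : ℕ) (t : Site (d + 1)) :
    shiftK (-((((L ^ m : ℕ) : ℤ)) • t)) (psiKSym r L m) = psiKSym r L m := by
  rw [← smul_neg]
  exact shiftK_psiKSym hL r m (-t)

/-- [folklore] `shiftK (n • v) Φ̂ˢ = Φ̂ˢ`. -/
theorem shiftK_phiKSym {L : ℕ} (hL : 1 ≤ L) (r : ℕ → (Fin (d + 1) → ℕ)) (m : ℕ) (v : Site (d + 1)) :
    shiftK ((((L ^ m : ℕ) : ℤ)) • v) (phiKSym r L m) = phiKSym r L m := by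
  funext x y a b
  exact phiKSym_shift hL r m x y v a b

/-- [folklore] `shiftK (−(n • t)) Φ̂ˢ = Φ̂ˢ`. -/
theorem shiftK_neg_phiKSym {L : ℕ} (hL : 1 ≤ L) (r : ℕ → (Fin (d + 1) → ℕ)) (m : ℕ) (t : Site (d + 1)) :
    shiftK (-((((L ^ m : ℕ) : ℤ)) • t)) (phiKSym r L m) = phiKSym r L m := by
  rw [← smul_neg]
  exact shiftK_phiKSym hL r m (-t)

end Shift

section Spread

variable {L : ℕ} (hL : 0 < L) {r : ℕ → (Fin (d + 1) → ℕ)} (hr : ∀ k, r k ∈ box (d + 1) L) (m : ℕ)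
include hL hr

/-- [folklore] Row-finiteness of `Ψ̂ˢ`: the field–field entry vanishes off the rooted read set `CorrReads (L^m) α x` (PART 127 `depOn_corrPsiSym`). -/
theorem psiKSym_inl_inl_eq_zero {x y : Site (d + 1)} {α β : Fin (d + 1)} (h : (β, y) ∉ CorrReads (L ^ m) α x) :
    psiKSym r L m x y (Sum.inl α) (Sum.inl β) = 0 :=
  apply_indR_eq_zero_of_not_mem (depOn_corrPsiSym hL hr m α x) (corrPsiSym_zero (r := r) (L := L) m) h

/-- [folklore] Row-finiteness of `Φ̂ˢ` (PART 127 `depOn_corrPhiSym`). -/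
theorem phiKSym_inl_inl_eq_zero {x y : Site (d + 1)} {α β : Fin (d + 1)} (h : (β, y) ∉ CorrReads (L ^ m) α x) :
    phiKSym r L m x y (Sum.inl α) (Sum.inl β) = 0 :=
  apply_indR_eq_zero_of_not_mem (depOn_corrPhiSym hL hr m α x) (corrPhiSym_zero (r := r) (L := L) m) h

/-- [folklore] **FINITE RANGE `0` IN BLOCK UNITS FOR `Ψ̂ˢ`** (`psiK_eq_idK_of_blk_ne`'s statement and proof). -/
theorem psiKSym_eq_idK_of_blk_ne {x y : Site (d + 1)} (h1 : blk (L ^ m) y ≠ blk (L ^ m) x)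
    (h2 : ∀ α : Fin (d + 1), blk (L ^ m) y ≠ blk (L ^ m) (x + unitVec α)) (a b : Fib d) :
    psiKSym r L m x y a b = idK x y a b := by
  classical
  have hxy : x ≠ y := fun e => h1 (by rw [e])
  rcases a with α | μ <;> rcases b with β | μ'
  · rw [idK_apply, if_neg (fun h => hxy h.1)]
    refine psiKSym_inl_inl_eq_zero hL hr m fun hp => ?_
    rcases hp with hp | hp | hp
    · exact hxy (Prod.ext_iff.1 hp).2.symm
    · exact h1 hp.1
    · exact h2 α hp.1
  · rw [psiKSym_inl_inr, idK_apply, if_neg (fun h => hxy h.1)]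
  · rw [psiKSym_inr_inl, idK_apply, if_neg (fun h => hxy h.1)]
  · rw [psiKSym_inr_inr, idK_apply]
    by_cases h : x = y ∧ μ = μ'
    · rw [if_pos h, if_pos ⟨h.1, congrArg Sum.inr h.2⟩]
    · rw [if_neg h, if_neg (fun h' => h ⟨h'.1, Sum.inr_injective h'.2⟩)]

/-- [folklore] **FINITE RANGE `0` IN BLOCK UNITS FOR `Φ̂ˢ`**. -/
theorem phiKSym_eq_idK_of_blk_ne {x y : Site (d + 1)} (h1 : blk (L ^ m) y ≠ blk (L ^ m) x)
    (h2 : ∀ α : Fin (d + 1), blk (L ^ m) y ≠ blk (L ^ m) (x + unitVec α)) (a b : Fib d) :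
    phiKSym r L m x y a b = idK x y a b := by
  classical
  have hxy : x ≠ y := fun e => h1 (by rw [e])
  rcases a with α | μ <;> rcases b with β | μ'
  · rw [idK_apply, if_neg (fun h => hxy h.1)]
    refine phiKSym_inl_inl_eq_zero hL hr m fun hp => ?_
    rcases hp with hp | hp | hp
    · exact hxy (Prod.ext_iff.1 hp).2.symm
    · exact h1 hp.1
    · exact h2 α hp.1
  · rw [phiKSym_inl_inr, idK_apply, if_neg (fun h => hxy h.1)]
  · rw [phiKSym_inr_inl, idK_apply, if_neg (fun h => hxy h.1)]
  · rw [phiKSym_inr_inr, idK_apply]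
    by_cases h : x = y ∧ μ = μ'
    · rw [if_pos h, if_pos ⟨h.1, congrArg Sum.inr h.2⟩]
    · rw [if_neg h, if_neg (fun h' => h ⟨h'.1, Sum.inr_injective h'.2⟩)]

/-- [folklore] **`Ψ̂ˢ` DECAYS AT EVERY RATE** `δ ≥ 0` (`decays_of_blockShift_of_range`). -/
theorem decays_psiKSym {δ : ℝ} (hδ : 0 ≤ δ) :
    Decays (psiKSym r L m) (kerBound (psiKSym r L m) (L ^ m) * Real.exp (δ * (2 * (((d : ℝ) + 1) * (L ^ m : ℕ))))) δ :=
  decays_of_blockShift_of_range (pow_pos hL m) (fun x y v a b => psiKSym_shift hL r m x y v a b)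
    (fun _ _ h1 h2 a b => psiKSym_eq_idK_of_blk_ne hL hr m h1 h2 a b) hδ

/-- [folklore] **`Φ̂ˢ` DECAYS AT EVERY RATE** `δ ≥ 0`. -/
theorem decays_phiKSym {δ : ℝ} (hδ : 0 ≤ δ) :
    Decays (phiKSym r L m) (kerBound (phiKSym r L m) (L ^ m) * Real.exp (δ * (2 * (((d : ℝ) + 1) * (L ^ m : ℕ))))) δ :=
  decays_of_blockShift_of_range (pow_pos hL m) (fun x y v a b => phiKSym_shift hL r m x y v a b)
    (fun _ _ h1 h2 a b => phiKSym_eq_idK_of_blk_ne hL hr m h1 h2 a b) hδ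

/-- [folklore] **`Spr Ψ̂ˢ`** — letter `hΨ` of `relInv_ANs`, DISCHARGED. -/
theorem spr_psiKSym : Spr (psiKSym r L m) := ⟨_, 1, one_pos, decays_psiKSym hL hr m zero_le_one⟩

/-- [folklore] **`Spr Φ̂ˢ`** — letter `hΦ` of `relInv_ANs`, DISCHARGED. -/
theorem spr_phiKSym : Spr (phiKSym r L m) := ⟨_, 1, one_pos, decays_phiKSym hL hr m zero_le_one⟩

end Spread

/-! ## §3 The apply bridges (K-U3d L2's generic bridges at the (0.4) forms) -/

section Bridges

variable {L : ℕ} (hL : 0 < L) {r : ℕ → (Fin (d + 1) → ℕ)} (hr : ∀ k, r k ∈ box (d + 1) L) (m : ℕ)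
include hL hr

/-- [folklore] **APPLY BRIDGE FOR `Ψ̂ˢ`, LEFT ACTION ON COLUMNS** (generic `comp_kerOf_inl` fed PART 127 `depOn_corrPsiSym`, PART 128 `corrPsiSym_sum_smul`). -/
theorem comp_psiKSym_inl (K : MKer (d + 1) (Fib d)) (x z : Site (d + 1)) (α : Fin (d + 1)) (b : Fib d) :
    comp (psiKSym r L m) K x z (Sum.inl α) b = corrPsiSym r L m (fun κ y => K y z (Sum.inl κ) b) α x :=
  comp_kerOf_inl (depOn_corrPsiSym hL hr m) (fun s c B => corrPsiSym_sum_smul (r := r) (L := L) m s c B) (exists_finset_corrReads hL m) K x z α b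

omit hL hr in
/-- [folklore] `comp Ψ̂ˢ K` on a multiplier row is `K`. -/
theorem comp_psiKSym_inr (K : MKer (d + 1) (Fib d)) (x z : Site (d + 1)) (μ : Fin (d + 1)) (b : Fib d) :
    comp (psiKSym r L m) K x z (Sum.inr μ) b = K x z (Sum.inr μ) b :=
  comp_kerOf_inr _ K x z μ b

/-- [folklore] **APPLY BRIDGE FOR `Φ̂ˢ`, LEFT ACTION ON COLUMNS** (generic `comp_kerOf_inl` fed PART 127 `depOn_corrPhiSym`, PART 128 `corrPhiSym_sum_smul`). -/
theorem comp_phiKSym_inl (K : MKer (d + 1) (Fib d)) (x z : Site (d + 1)) (α : Fin (d + 1)) (b : Fib d) :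
    comp (phiKSym r L m) K x z (Sum.inl α) b = corrPhiSym r L m (fun κ y => K y z (Sum.inl κ) b) α x :=
  comp_kerOf_inl (depOn_corrPhiSym hL hr m) (fun s c B => corrPhiSym_sum_smul (r := r) (L := L) m s c B) (exists_finset_corrReads hL m) K x z α b

omit hL hr in
/-- [folklore] `comp Φ̂ˢ K` on a multiplier row is `K`. -/
theorem comp_phiKSym_inr (K : MKer (d + 1) (Fib d)) (x z : Site (d + 1)) (μ : Fin (d + 1)) (b : Fib d) :
    comp (phiKSym r L m) K x z (Sum.inr μ) b = K x z (Sum.inr μ) b :=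
  comp_kerOf_inr _ K x z μ b

/-- [folklore] **APPLY BRIDGE FOR `Ψ̂ˢ`, RIGHT ACTION ON ROWS** (generic `comp_trK_kerOf_inl`). -/
theorem comp_trK_psiKSym_inl (K : MKer (d + 1) (Fib d)) (x z : Site (d + 1)) (a : Fib d) (β : Fin (d + 1)) :
    comp K (trK (psiKSym r L m)) x z a (Sum.inl β) = corrPsiSym r L m (fun κ y => K x y a (Sum.inl κ)) β z :=
  comp_trK_kerOf_inl (depOn_corrPsiSym hL hr m) (fun s c B => corrPsiSym_sum_smul (r := r) (L := L) m s c B) (exists_finset_corrReads hL m) K x z a β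

omit hL hr in
/-- [folklore] `comp K (trK Ψ̂ˢ)` on a multiplier column is `K`. -/
theorem comp_trK_psiKSym_inr (K : MKer (d + 1) (Fib d)) (x z : Site (d + 1)) (a : Fib d) (μ : Fin (d + 1)) :
    comp K (trK (psiKSym r L m)) x z a (Sum.inr μ) = K x z a (Sum.inr μ) :=
  comp_trK_kerOf_inr _ K x z a μ

/-- [folklore] **APPLY BRIDGE FOR `Φ̂ˢ`, RIGHT ACTION ON ROWS** (generic `comp_trK_kerOf_inl`). -/
theorem comp_trK_phiKSym_inl (K : MKer (d + 1) (Fib d)) (x z : Site (d + 1)) (a : Fib d) (β : Fin (d + 1)) :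
    comp K (trK (phiKSym r L m)) x z a (Sum.inl β) = corrPhiSym r L m (fun κ y => K x y a (Sum.inl κ)) β z :=
  comp_trK_kerOf_inl (depOn_corrPhiSym hL hr m) (fun s c B => corrPhiSym_sum_smul (r := r) (L := L) m s c B) (exists_finset_corrReads hL m) K x z a β

omit hL hr in
/-- [folklore] `comp K (trK Φ̂ˢ)` on a multiplier column is `K`. -/
theorem comp_trK_phiKSym_inr (K : MKer (d + 1) (Fib d)) (x z : Site (d + 1)) (a : Fib d) (μ : Fin (d + 1)) :
    comp K (trK (phiKSym r L m)) x z a (Sum.inr μ) = K x z a (Sum.inr μ) :=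
  comp_trK_kerOf_inr _ K x z a μ

end Bridges


/-! ## §4 Graded symmetry: every kerneliser is `sgnK`-fixed -/

section Parity

/-- [folklore] **EVERY KERNELISER IS `sgnK`-FIXED** (generic — `FP/CompositeOneShotChartParity.sgnK_psiK`'s proof at `kerOf`: no field∕multiplier cross blocks,
`sgnF a · sgnF b = 1` on the diagonal blocks). -/
theorem sgnK_kerOf (T : Form1 (d + 1) ℝ → Form1 (d + 1) ℝ) : sgnK (kerOf T) = kerOf T := by
  funext x y a b
  rw [sgnK_apply]
  rcases a with α | μ <;> rcases b with β | μ'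
  · rw [sgnF_inl, sgnF_inl, one_mul, one_mul]
  · rw [kerOf_inl_inr, mul_zero]
  · rw [kerOf_inr_inl, mul_zero]
  · rw [sgnF_inr, sgnF_inr]; ring

/-- [folklore] `sgnK Ψ̂ˢ_m = Ψ̂ˢ_m`. -/
theorem sgnK_psiKSym (r : ℕ → (Fin (d + 1) → ℕ)) (L m : ℕ) : sgnK (psiKSym r L m) = psiKSym r L m := sgnK_kerOf _

/-- [folklore] `sgnK Φ̂ˢ_m = Φ̂ˢ_m`. -/
theorem sgnK_phiKSym (r : ℕ → (Fin (d + 1) → ℕ)) (L m : ℕ) : sgnK (phiKSym r L m) = phiKSym r L m := sgnK_kerOf _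

end Parity

end

end Summit.QuantumFields.BalabanUV.Beta.CompositeCorrectorKernelSym
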